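import Summits.ResolutionOfSingularities.ResolutionOfSingularities.Theorems.WeightedInvariantIota3DropCurveAQSDatum
import Summits.ResolutionOfSingularities.ResolutionOfSingularities.Theorems.WeightedInvariantIota3CurveLexMaxTieFree
import Summits.ResolutionOfSingularities.ResolutionOfSingularities.Theorems.WeightedInvariantKeyRungThreeOfDropCurveTie
import Summits.ResolutionOfSingularities.ResolutionOfSingularities.Theorems.WeightedInvariantHypersurfaceLocalGameEFT4SDimLETwoOpenFinal
import HarnessLib

/-!
# (D-b³-curve) PROVED at curve centres whose Abramovich–Quek–Schober slope is an INTEGER: `b_max = r`, the AQS datum presents `J₃ᵗ`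
# and is tie-free, so the ORDER drops at every successor over the closed point
# (door `HypersurfaceCentreConstruction`, stmt-ResolutionOfSingularities-19897; residual (D-b³-curve-TIE) of `stub_keyRungGrHomLE_three`)

Helper for `stub_keyRungGrHomLE_three` (def-free, `--supports 19897`).  Sequel of hand -8's …Iota3DropCurveAQSDatum (the AQS germ
`(y/1, x/1; r, q; rν)` of `f/1` at the curve centre `P = (x, y)` presented by a regular system of parameters of `S`), …Iota3CurveLexMaxTieFree (that
datum is tie-free for its own weights) and hand -7's …Iota3DropCurveB (`dropb3_curve_of_tieFree_datum`).

* **`Iota3.bMax_eq_of_lexMax_weight_one`** — `O` regular local of dimension `2`, excellent; `0 ≠ f` not of monomial type; `(x₁, y₁)` a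
  regular system of parameters with `(y₁, x₁; r, 1; rν)` lex-maximal for `(f)`, `ν = ord f`: then `b_max f = r` and `y₁` carries `f` to
  the terminal integer level (`r` is reached by `y₁`; a reached level `b'` gives the admissible centre `(g, x'; b', 1; b'ν)`, so `b' ≤ r` by
  lex-maximality).
* **`Iota3.dropb3_curve_of_integer_slope`** — at a curve centre `P ≠ 𝔪` of a three-dimensional door position with an `S`-presented AQS datum
  of weights `(r, 1)`: for EVERY family `(u, w)` presenting `J₃ᵗ`, `ι₃ᵗ` drops at every `t`-homogeneous successor over the closed point
  (`J₃ᵗ = 𝒥((y, x); (r, 1))` by the cylinder value with `b_max = r`; `htie`/`htie'` by `not_mem_tie(')_of_curve_lexMax`; then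
  `dropb3_curve_of_tieFree_datum`).
So the residual (D-b³-curve-TIE) of …KeyRungThreeOfDropCurveTie lives only at curve centres with FRACTIONAL AQS slope (`q ≥ 2`):
the sequel …KeyRungThreeOfDropCurveFrac states that gap list.
[OURS · L1 W4.3 · audit glue; AI work, weaker than expert review; nothing here is a statement of the manuscript under review.]

## References

* D. Abramovich, M. H. Quek, B. Schober, arXiv:2507.01232 (2025), Thm 1.3 (3), Thm 3.5. [AbramovichQuekSchober2025]
* V. Cossart, U. Jannsen, S. Saito, LNM 2270 (2020), Ch. 8. [CossartJannsenSaito2020]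
-/

noncomputable section

set_option linter.dupNamespace false -- mandated namespace of this single-conjunct summit

open IsLocalRing Literature.AlgebraicGeometry.Resolution
open Summit.ResolutionOfSingularities.ResolutionOfSingularities.Theorems
open Summit.ResolutionOfSingularities.ResolutionOfSingularities.Theorems.ContactCylinder

namespace Summit.ResolutionOfSingularities.ResolutionOfSingularities.Cruxes.HypersurfaceCentreConstruction.LocalEngine

namespace Iota3

/-! ## `b_max = r` when the lex-maximal weights are `(r, 1)` -/

/-- **The terminal integer contact level of an AQS datum with weights `(r, 1)` is `r`, attained by its contact parameter.**
[OURS · L1 W4.3] [cite: AbramovichQuekSchober2025, Thm 3.5] [cite: CossartJannsenSaito2020, Ch. 8] -/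
theorem bMax_eq_of_lexMax_weight_one (O : Type) [CommRing O] [IsRegularLocalRing O] (hS : IsExcellentRing O)
    (hdim : ringKrullDim O = (2 : ℕ)) {f : O} (hf0 : f ≠ 0) (hnm : ¬ IsMonomialType f)
    {x₁ y₁ : O} (hx₁y₁ : Ideal.span {x₁, y₁} = maximalIdeal O) {r ν : ℕ} (hν : (adicOrder f).toNat = ν) (hν1 : 1 ≤ ν)
    (hlex : IsLexMaxWeightedCentreGerm O (Ideal.span {f}) ![y₁, x₁] ![r, 1] (r * ν)) :
    bMax f = r ∧ f ∈ contactFiltration y₁ (bMax f) (bMax f * (adicOrder f).toNat) := by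
  obtain ⟨-, hpos, -, -, -, -, hadm, hmax, -⟩ := hlex
  have hr1 : 1 ≤ r := hpos 0
  have hdim2 : ringKrullDim O = 2 := by rw [hdim]; rfl
  obtain ⟨hx₁2, hy₁2⟩ := LocalGameEFTSteepening.not_mem_sq_of_span_pair_eq hdim hx₁y₁
  have hy₁ : y₁ ∈ maximalIdeal O := hx₁y₁ ▸ Ideal.subset_span (by simp)
  -- `r` is reached by `y₁`
  have hreach : f ∈ contactFiltration y₁ r (r * ν) := by
    have h := (Ideal.span_singleton_le_iff_mem _).mp hadm
    rw [AQSHeightTwo.weightedMonomialIdeal_swap, ContactFiltration.weightedMonomialIdeal_eq_contactFiltration hx₁y₁ hr1,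
      ← contactFiltration_def] at h
    exact h
  have hf2 : f ∈ maximalIdeal O ^ 2 := mem_sq_of_not_isMonomialType hf0 hnm ⟨y₁, hy₁, hy₁2⟩
  have hle : r ≤ bMax f := le_bMax_of_reaches O hS hf0 hf2 hnm hr1 ⟨y₁, hy₁, hy₁2, by rw [hν]; exact hreach⟩
  -- every reached level is `≤ r`
  obtain ⟨hb1, g, hg, hg2, hgreach⟩ := one_le_bMax_and_reaches O hS hf0 hf2 hnm
  rw [hν] at hgreach
  obtain ⟨x', -, hx'g⟩ := GenericEquimultiplicity.exists_span_pair_eq_maximalIdeal_of_not_mem_sq hdim2 hg hg2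
  have hadm' : Ideal.span {f} ≤ weightedMonomialIdeal ![g, x'] ![bMax f, 1] (bMax f * ν) := by
    rw [Ideal.span_singleton_le_iff_mem, AQSHeightTwo.weightedMonomialIdeal_swap,
      ContactFiltration.weightedMonomialIdeal_eq_contactFiltration hx'g hb1, ← contactFiltration_def]
    exact hgreach
  have hrange : Ideal.span (Set.range ![g, x']) = maximalIdeal O := by
    rw [show Set.range ![g, x'] = {g, x'} by
      rw [Matrix.range_cons, Matrix.range_cons, Matrix.range_empty, Set.union_empty, Set.singleton_union],
      Ideal.span_pair_comm, hx'g]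
  have hcmp := hmax ![g, x'] ![bMax f, 1] (bMax f * ν) hrange
    (fun i => by fin_cases i; exacts [hb1, Nat.one_pos]) hb1 (Nat.mul_pos hb1 hν1) hadm'
  simp only [Matrix.cons_val_zero, Matrix.cons_val_one, mul_one] at hcmp
  have hge : bMax f ≤ r := by
    rcases hcmp with h1 | ⟨-, h2⟩
    · exfalso
      have : bMax f * ν * r = r * ν * bMax f := by ring
      omega
    · exact Nat.le_of_mul_le_mul_right (by simpa [Nat.mul_comm] using h2) hν1
  have hbr : bMax f = r := le_antisymm hge hle
  refine ⟨hbr, ?_⟩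
  rw [hbr, hν]; exact hreach

/-! ## (D-b³-curve) at curve centres with integer AQS slope -/

/-- **(D-b³-curve) WHEN THE AQS SLOPE IS AN INTEGER.**  `k₀` a field; `S` regular local essentially of finite type over `k₀`, `ringKrullDim S = 3`;
`0 ≠ f ∈ 𝔪`; `P ≠ 𝔪` prime with `topStratum ι₀ S f = V(P)`, `S ⧸ P` regular, `¬ dim S_P ≤ 1`; `(x, y, z)` a regular system of parameters with
`(x, y) = P` presenting the AQS germ of `f/1` with weights `(r, 1)`: `IsLexMaxWeightedCentreGerm (S_P) (f/1) ![y/1, x/1] ![r, 1] (rν)`,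
`f ∈ 𝔪^ν ∖ 𝔪^{ν+1}`.  Then for every `(u, w)` with `weightedMonomialIdeal u w = jFlatT S f`, at every `t`-homogeneous successor prime `𝔫` of
`cobordantAlgebra' u w` over the closed point, off the vertex, and every `f = (t⁻¹)ᵃ g`, `t⁻¹ ∤ g`, `g/1 ∈ 𝔪_𝔫²`:
`iotaFlatT (B_𝔫) (g/1) < iotaFlatT S f`. [OURS · L1 W4.3 · (D-b³-curve), integer slope] [cite: AbramovichQuekSchober2025, Thm 1.3 (3)] -/
theorem dropb3_curve_of_integer_slope (k₀ : Type) [Field k₀]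
    (S : Type) [CommRing S] [Algebra k₀ S] [Algebra.EssFiniteType k₀ S] [IsRegularLocalRing S]
    (f : S) (hd : ringKrullDim S = 3) (hf0 : f ≠ 0) (hf : f ∈ maximalIdeal S)
    (P : Ideal S) [P.IsPrime] (hreg : IsRegularLocalRing (S ⧸ P))
    (hE : topStratum iotaOrdEpsTau S f = {𝔮 | P ≤ 𝔮.asIdeal}) (hP1 : ¬ ringKrullDim (Localization.AtPrime P) ≤ 1)
    (hPm : P ≠ maximalIdeal S) {x y z : S} (hPeq : Ideal.span ({x, y} : Set S) = P) (hxyz : Ideal.span {x, y, z} = maximalIdeal S)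
    {r ν : ℕ} (hfν : f ∈ maximalIdeal S ^ ν) (hfν1 : f ∉ maximalIdeal S ^ (ν + 1))
    (hlex : IsLexMaxWeightedCentreGerm (Localization.AtPrime P) (Ideal.span {algebraMap S (Localization.AtPrime P) f})
      ![algebraMap S (Localization.AtPrime P) y, algebraMap S (Localization.AtPrime P) x] ![r, 1] (r * ν))
    {n : ℕ} (u : Fin n → S) (w : Fin n → ℕ) (hpres : ∀ m : ℕ, weightedMonomialIdeal u w m = jFlatT S f m) :
    ∀ (𝔫 : Ideal (cobordantAlgebra' u w)) [𝔫.IsPrime], IsTHomogeneous u w 𝔫 → cobordantT' u w ∈ 𝔫 →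
      (maximalIdeal S).map (algebraMap S (cobordantAlgebra' u w)) ≤ 𝔫 →
      ¬ extReesAlgebra.vertexIdeal (weightedMonomialIdeal u w) ≤ 𝔫 →
      ∀ (a : ℕ) (g : cobordantAlgebra' u w), algebraMap S (cobordantAlgebra' u w) f = cobordantT' u w ^ a * g →
        ¬ cobordantT' u w ∣ g →
        algebraMap (cobordantAlgebra' u w) (Localization.AtPrime 𝔫) g ∈ maximalIdeal (Localization.AtPrime 𝔫) ^ 2 →
        iotaFlatT (Localization.AtPrime 𝔫) (algebraMap (cobordantAlgebra' u w) (Localization.AtPrime 𝔫) g) < iotaFlatT S f := by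
  classical
  -- tie-freeness of the AQS datum in the curve regime
  have hq1 : ringKrullDim (S ⧸ P) = 1 := ringKrullDim_quotient_eq_one_of_curveCentre hd P hreg hP1 hPm
  have htie : ∀ lam : S, f ∉ weightedMonomialIdeal ![x, y - lam * x ^ r, z] ![1, r + 1, 1] ((r + 1) * ν) :=
    not_mem_tie_of_curve_lexMax hd hf0 hf P hE hP1 hPm hq1 hPeq hxyz hfν hfν1 hlex
  have htie' : 1 = r → f ∉ weightedMonomialIdeal ![y, x, z] ![1, 2, 1] (2 * ν) := by
    rintro rfl
    exact not_mem_tie'_of_curve_lexMax hd hf0 hf P hE hP1 hPm hq1 hPeq hxyz hfν hfν1 hlex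
  subst hPeq
  haveI : IsDomain S := isDomain_of_isRegularLocalRing S
  have hdle : ringKrullDim S ≤ 3 := le_of_eq hd
  have hd3 : ringKrullDim S = (3 : ℕ) := by rw [hd]; rfl
  have hrk : (maximalIdeal S).spanFinrank = 3 := by
    have h := IsRegularLocalRing.spanFinrank_maximalIdeal (R := S)
    rw [hd3] at h
    exact_mod_cast h
  have hr1 : 1 ≤ r := hlex.2.1 0
  have hadmO := (Ideal.span_singleton_le_iff_mem _).mp hlex.2.2.2.2.2.2.1
  -- the order and the pair `(x, y)`
  obtain ⟨ν', hν'⟩ := Ordinal.lt_omega0.mp (iotaOrd_lt_omega0_of_ne_zero S hf0)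
  obtain ⟨hfν', hfν1'⟩ := (iotaOrd_eq_natCast_iff S f ν').mp hν'
  obtain rfl : ν = ν' := eq_of_mem_pow_of_not_mem_pow hfν hfν1 hfν' hfν1'
  have hν1 : 1 ≤ ν := by
    by_contra h
    have h0 : ν = 0 := by omega
    rw [h0, zero_add, pow_one] at hfν1
    exact hfν1 hf
  have hP₀ : topStratumPrime iotaOrdEpsTau S f = Ideal.span {x, y} :=
    ContactCylinder.topStratumPrime_eq_of_topStratum_eq iotaOrdEpsTau S f hE
  obtain ⟨_, -, -, -, -, hfPν⟩ := topStratumPrime_iotaOrdEpsTau_spec hdle hf0 hf hν'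
  rw [hP₀] at hfPν
  have hr₀ : Ideal.span (Set.range ![x, y, z]) = maximalIdeal S := by rw [range_three]; exact hxyz
  have hxg : ∀ i, (![x, y] : Fin 2 → S) i ∈ maximalIdeal S := LocalGameEFTCylinder.mem_maximalIdeal_pair hr₀
  have hli := LocalGameEFTCylinder.linearIndependent_toCotangent_pair hr₀ hrk
  -- the position `(S_P, f/1)`
  set O := Localization.AtPrime (Ideal.span ({x, y} : Set S)) with hO
  haveI : IsRegularLocalRing O := isRegularLocalRing_localization_atPrime S _
  haveI : Algebra.EssFiniteType k₀ O := Algebra.EssFiniteType.comp k₀ S O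
  have hexc : IsExcellentRing O := (Stacks07QW_field_holds k₀ k₀ inferInstance).of_essFiniteType inferInstance
  have hdimO : ringKrullDim O = (2 : ℕ) :=
    ringKrullDim_localization_eq_two_of_curveCentre hd (Ideal.span ({x, y} : Set S)) hP1 hPm
  have hdimP : ringKrullDim O ≤ 2 := le_of_eq (hdimO.trans rfl)
  have hf0' : algebraMap S O f ≠ 0 := fun h =>
    hf0 ((injective_iff_map_eq_zero _).mp
      (IsLocalization.injective O (Ideal.span ({x, y} : Set S)).primeCompl_le_nonZeroDivisors) f h)
  obtain ⟨hmax₀, hy2, -, -⟩ := Descent.pair_facts (Ideal.span ({x, y} : Set S)) hxg hli rfl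
  have hnm : ¬ IsMonomialType (algebraMap S O f) :=
    JFlatEssSmooth.not_isMonomialType_of_topStratumPrime_eq hdle hf0 hf x y hxg hli hP₀
  have hιP : iotaOrd O (algebraMap S O f) = iotaOrd S f :=
    EquimultipleCentre.iotaOrd_localization_eq_of_mem_pow (Ideal.span ({x, y} : Set S)) le_rfl hν' hfPν
  obtain ⟨hfνO, hfνO1⟩ := (iotaOrd_eq_natCast_iff O _ ν).mp (hιP.trans hν')
  have hνO : (adicOrder (algebraMap S O f)).toNat = ν := by
    obtain ⟨ν₂, -, hν₂, -, h1, h2⟩ := exists_adicOrder_eq_of_not_isMonomialType hf0' hnm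
      ⟨_, hmax₀ ▸ Ideal.subset_span (by simp), hy2⟩
    rw [hν₂]; exact (eq_of_mem_pow_of_not_mem_pow hfνO hfνO1 h1 h2).symm
  -- `b_max = r`, the cylinder value `J₃ᵗ = 𝒥((y, x); (r, 1))`, admissibility
  obtain ⟨hbr, hreach⟩ := bMax_eq_of_lexMax_weight_one O hexc hdimO hf0' hnm hmax₀ hνO hν1 hlex
  have hb : 1 ≤ bMax (algebraMap S O f) := by rw [hbr]; exact hr1
  have hcyl : ∀ m : ℕ, (jContact O (algebraMap S O f) m).comap (algebraMap S O) =
      weightedMonomialIdeal ![x, y] ![1, bMax (algebraMap S O f)] m :=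
    fun m => cylinder_comap_eq_weightedMonomialIdeal S x y hxg hli f hf0' hnm hreach hb m
  have hJ : ∀ m : ℕ, jFlatT S f m = weightedMonomialIdeal ![y, x] ![r, 1] m := fun m => by
    rw [jFlatT_eq_cylinderAt_jContact S f m hE hdimP, cylinderAt_def, hcyl m, hbr, AQSHeightTwo.weightedMonomialIdeal_swap]
  have hadm : f ∈ weightedMonomialIdeal ![y, x] ![r, 1] (r * ν) := by
    rw [← hJ (r * ν), jFlatT_eq_cylinderAt_jContact S f _ hE hdimP, cylinderAt_def, Ideal.mem_comap,
      ← weightedMonomialIdeal_eq_jContact O hf0' hnm hmax₀ hy2 hb hreach (r * ν), hbr]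
    rwa [AQSHeightTwo.weightedMonomialIdeal_swap] at hadmO
  -- hand -7's type (b) order drop with weights `(r, 1)`
  haveI hPyx : (Ideal.span (Set.range ![y, x])).IsPrime := by
    rw [show Set.range ![y, x] = {y, x} by
      rw [Matrix.range_cons, Matrix.range_cons, Matrix.range_empty, Set.union_empty, Set.singleton_union], Ideal.span_pair_comm]
    infer_instance
  have hyxz : Ideal.span (Set.range ![y, x, z]) = maximalIdeal S := by rw [range_three, Set.insert_comm]; exact hxyz
  intro 𝔫 _ hhom hT hM hV a g hfg hTg hg2
  exact dropb3_curve_of_tieFree_datum hyxz hrk Nat.one_pos hr1 (Nat.coprime_one_right r) hν1 hfν hfν1 hadm htie htie' u w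
    (fun m => by rw [hpres m, hJ m]) 𝔫 hhom hT hM hV a g hfg hTg hg2

end Iota3

end Summit.ResolutionOfSingularities.ResolutionOfSingularities.Cruxes.HypersurfaceCentreConstruction.LocalEngine

end
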